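import Summits.ResolutionOfSingularities.KangarooAtlas.MizutaniEdgeDatum
import Summits.ResolutionOfSingularities.KangarooAtlas.MizutaniHironakaSide
import HarnessLib

/-!
# Mizutani's theorem in Hironaka's edge datum: `2 · ridgeTopDegree ≤ ridgeDim + 1` for the group `B_{P,𝔭}` of every point

Cell `pub-rosobs`, Mizutani enclosure (seat mizutani-encloser-2, gen 5). AI-written; AI review is weaker than expert
review; NOT a resolution-of-singularities theorem (summit relevance C).

Sequel of `MizutaniEdgeDatum.lean` (triangular basis `U(𝔭) = k[σ_1, …, σ_r]`, `dim_k (U ∩ L)_e = #{e_j ≤ e}`, generation / failure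
of generation of `U ∩ L` at the levels `max e_j` / below, `dim B_{P,𝔭} = n + 1 − r = ridgeDim`, `ridgeTopDegree` vs. `p^{max e_j}`), now
combined with encloser-1 g4's Oda equality `hirForms_eq_invForms` (Oda 1973 Prop. 2.2 (ii), `MizutaniOdaEquality*.lean`) and the
unconditional Hironaka-side bound `mizutani_lowerBound_hironaka` (`MizutaniHironakaSide.lean`):

* **`exponent_eq_sup_expo`** — Oda's = Mizutani's exponent `exponent k p 𝔭 = max_j e_j` (`0` for `r = 0`), read off ANY triangular
  presentation of `U(𝔭)`; **`hsDim_eq_sub_r`** — `hsDim k p 𝔭 = n + 1 − r`;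
* **`two_mul_ridgeTopDegree_le_ridgeDim_succ`** — MIZUTANI'S THEOREM (`m(e) ≥ 2p^e − 1`, Remark 2.10, proved by the cell) IN HIRONAKA'S
  EDGE DATUM: for the homogeneous additive group `B_{P,𝔭} ⊆ 𝔸^{n+1}` of every point `𝔭` of every `ℙ^n_k`, twice the largest
  generator degree of its ridge is at most `dim + 1` — `2 · ridgeTopDegree (ridgeEdgeInv p (U_+(𝔭)S)) ≤ ridgeDim (U_+(𝔭)S) + 1`;
* **`ridgeTopDegree_attP_and_ridgeDim_attP`** — attained by Mizutani's `H_e` (`GenAtt.attP`): `ridgeTopDegree = p^e`, `ridgeDim = 2p^e − 1`.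

## References

* H. Mizutani, *Hironaka's additive group schemes*, Nagoya Math. J. 52 (1973) 85–95, §1 (c), Thm. 1.3, Thm. 2.8, Remark 2.10.
  [Mizutani1973HironakaGroupSchemes]
* H. Hironaka, *Additive groups associated with points of a projective space*, Ann. of Math. 92 (1970), Th. 1. [Hironaka1970AdditiveGroups]
* V. Cossart, U. Jannsen, S. Saito, LNM 2270 (2020), Remark 18.29 (dimension of the ridge). [CossartJannsenSaito2020]
-/

noncomputable section

open MvPolynomial Literature.AlgebraicGeometry.Resolution Literature.AlgebraicGeometry.Resolution.HironakaScheme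
open Literature.AlgebraicGeometry.Hironaka2017.EdgeAlgebra Literature.AlgebraicGeometry.Hironaka2017.Datum

namespace Summit.ResolutionOfSingularities.KangarooAtlas.Mizutani

universe u

/-! ## Mizutani's theorem in Hironaka's edge datum -/

section Mizutani

variable (k : Type u) [Field k] (p : ℕ) [hp : Fact p.Prime] [CharP k p] {n : ℕ}
  (𝔭 : Ideal (MvPolynomial (Fin (n + 1)) k))

/-- **The exponent of `B_{P,𝔭}` is `max_j e_j`** (Oda's = Mizutani's exponent, tree `exponent k p 𝔭`, read off any triangular
presentation of `U(𝔭)`; `0` when `r = 0`). [cite: Mizutani1973HironakaGroupSchemes, §1 (c)] -/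
theorem exponent_eq_sup_expo [𝔭.IsPrime] (P : TriangularPresentation p (multAlgebra k 𝔭)) :
    exponent k p 𝔭 = Finset.univ.sup P.expo := by
  classical
  set E := Finset.univ.sup P.expo with hE_def
  have hE : ∀ i : Fin P.r, P.expo i ≤ E := fun i => Finset.le_sup (Finset.mem_univ i)
  refine (exponent_eq_iff_hirForms 𝔭 E).mpr ⟨fun j hj => ?_, fun e' he' hgen => ?_⟩
  · refine le_antisymm (hirForms_le_span_frobVec_image_of_forall_expo_le k p 𝔭 P hE hj) ?_
    have h := span_frobVec_image_hirForms_le (𝔭 := 𝔭) (j - E) E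
    rwa [Nat.add_sub_cancel' hj] at h
  · -- `E > e' ≥ 0` forces `r ≥ 1` and `E = e_i` for some `i`
    have hne : (Finset.univ : Finset (Fin P.r)).Nonempty := by
      by_contra h0
      rw [Finset.not_nonempty_iff_eq_empty] at h0
      rw [hE_def, h0, Finset.sup_empty] at he'
      exact Nat.not_lt_zero _ he'
    obtain ⟨i, -, hi⟩ := Finset.exists_mem_eq_sup Finset.univ hne P.expo
    have hlt : e' < P.expo i := by rw [← hi]; exact he'
    exact not_hirForms_le_span_frobVec_image k p 𝔭 P i hlt (hgen (P.expo i) hlt.le).le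

/-- **Oda's dimension `hsDim` is `n + 1 − r`.** [cite: Mizutani1973HironakaGroupSchemes, Thm. 1.3] -/
theorem hsDim_eq_sub_r [𝔭.IsPrime] (P : TriangularPresentation p (multAlgebra k 𝔭)) :
    hsDim k p 𝔭 = n + 1 - P.r := by
  classical
  set E := Finset.univ.sup P.expo with hE_def
  have hE : ∀ i : Fin P.r, P.expo i ≤ E := fun i => Finset.le_sup (Finset.mem_univ i)
  have hgen : ∀ j, E ≤ j → hirForms k p 𝔭 j =
      Submodule.span k (frobVec k p (j - E) '' (hirForms k p 𝔭 E : Set (Fin (n + 1) → k))) :=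
    ((exponent_eq_iff_hirForms 𝔭 E).mp (exponent_eq_sup_expo k p 𝔭 P)).1
  rw [hsDim_eq_hirForms 𝔭 hgen, finrank_hirForms_eq_card k p 𝔭 P E, Fintype.card_subtype,
    Finset.filter_true_of_mem fun i _ => hE i, Finset.card_univ, Fintype.card_fin]

include hp in
/-- **MIZUTANI'S THEOREM IN HIRONAKA'S EDGE DATUM, for every point of every `ℙ^n_k`**: twice the largest generator degree of the
ridge of the homogeneous additive group `B_{P,𝔭}` is at most `dim B_{P,𝔭} + 1`:
`2 · ridgeTopDegree ≤ ridgeDim + 1` (for `q_r = p^e`, `e ≥ 1`: `dim B_{P,𝔭} ≥ 2p^e − 1`; the tree's `mizutaniLowerBound` through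
encloser-1's `mizutani_lowerBound_hironaka`). [cite: Mizutani1973HironakaGroupSchemes, Thm. 2.8 and Remark 2.10] -/
theorem two_mul_ridgeTopDegree_le_ridgeDim_succ [𝔭.IsPrime] (hP : IsPoint k 𝔭) :
    haveI : ExpChar k p := ExpChar.prime hp.out
    2 * ridgeTopDegree (ridgeEdgeInv p (bIdeal k 𝔭)) ≤ ridgeDim (bIdeal k 𝔭) + 1 := by
  haveI : ExpChar k p := ExpChar.prime hp.out
  obtain ⟨P⟩ := nonempty_triangularPresentation_multAlgebra k p 𝔭 hP
  classical
  have hE : ∀ i : Fin P.r, P.expo i ≤ exponent k p 𝔭 := fun i => by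
    rw [exponent_eq_sup_expo k p 𝔭 P]; exact Finset.le_sup (Finset.mem_univ i)
  have htop : ridgeTopDegree (ridgeEdgeInv p (bIdeal k 𝔭)) ≤ p ^ exponent k p 𝔭 := ridgeTopDegree_le_pow k p 𝔭 hP P hE
  have hM := mizutani_lowerBound_hironaka k p 𝔭 hP
  rw [ringKrullDim_quotient_bIdeal_eq_ridgeDim k p 𝔭 hP] at hM
  have hM' : 2 * p ^ exponent k p 𝔭 ≤ ridgeDim (bIdeal k 𝔭) + 1 := by exact_mod_cast hM
  omega

/-- **…and the bound is attained**: for a `p`-independent pair `u` and `e ≥ 1`, Mizutani's point `attP k p e u` has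
`ridgeTopDegree = p^e` and `ridgeDim = 2p^e − 1`. [cite: Mizutani1973HironakaGroupSchemes, Remark 2.10 (H_e)] -/
theorem ridgeTopDegree_attP_and_ridgeDim_attP {k : Type u} [Field k] {p e : ℕ} [hp : Fact p.Prime] [CharP k p]
    {u : Fin 2 → k} (hu : PIndep p 1 u) (he : 1 ≤ e) :
    haveI : ExpChar k p := ExpChar.prime hp.out
    ridgeTopDegree (ridgeEdgeInv p (bIdeal k (GenAtt.attP k p e u))) = p ^ e ∧
      ridgeDim (bIdeal k (GenAtt.attP k p e u)) + 1 = 2 * p ^ e := by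
  haveI : ExpChar k p := ExpChar.prime hp.out
  have hP : IsPoint k (GenAtt.attP k p e u) := GenAtt.isPoint_attP fun l => GenAtt.ne_zero_of_pIndep hu l
  haveI : (GenAtt.attP k p e u).IsPrime := hP.1
  obtain ⟨hexp, hdim⟩ := mizutani_attained_hironaka hu he
  obtain ⟨P⟩ := nonempty_triangularPresentation_multAlgebra k p (GenAtt.attP k p e u) hP
  classical
  have hsup : Finset.univ.sup P.expo = e := by rw [← exponent_eq_sup_expo k p _ P, hexp]
  have hE : ∀ i : Fin P.r, P.expo i ≤ e := fun i => (Finset.le_sup (Finset.mem_univ i)).trans hsup.le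
  -- some generator has exponent exactly `e ≥ 1` (so `r ≥ 1`)
  have hne : (Finset.univ : Finset (Fin P.r)).Nonempty := by
    by_contra h0
    rw [Finset.not_nonempty_iff_eq_empty] at h0
    rw [h0, Finset.sup_empty] at hsup
    have : e = 0 := by rw [← hsup]; rfl
    omega
  obtain ⟨i, -, hi⟩ := Finset.exists_mem_eq_sup Finset.univ hne P.expo
  refine ⟨le_antisymm (ridgeTopDegree_le_pow k p _ hP P hE) ?_, ?_⟩
  · have h := pow_expo_le_ridgeTopDegree k p _ hP P i
    have h1 : p ^ e = p ^ P.expo i := by rw [← hi, hsup]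
    rw [h1]
    exact h
  · rw [ringKrullDim_quotient_bIdeal_eq_ridgeDim k p _ hP] at hdim
    exact_mod_cast hdim

end Mizutani

end Summit.ResolutionOfSingularities.KangarooAtlas.Mizutani

end
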